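import Summits.QuantumFields.YangMills.Theses.UnitScaleTilt
import Literature.MathematicalPhysics.QuantumFieldTheory.Balaban1983to89.T3FinestHeightTail
import Literature.MathematicalPhysics.QuantumFieldTheory.Balaban1983to89.T3Thresholds
import Literature.MathematicalPhysics.QuantumFieldTheory.Balaban1983to89.BlockAveragingPlaquetteBound
import Literature.MathematicalPhysics.QuantumFieldTheory.Balaban1983to89.T4PairDerivBridge
import Literature.MathematicalPhysics.QuantumFieldTheory.Balaban1983to89.T3UpperLiftSplit

/-!
# Route `UnitScaleTilt` — crux K2 `HistoryTail` (stmt-QuantumFields-18916), line v3b: the PER-PLAQUETTE SCHEMA of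
# `stub_perPlaquetteOfAlpha` AT BOUNDED HEIGHT `j ≤ j₀`, PROVED UNCONDITIONALLY (support file; the stub and K2 stay open)

Fleet lead `ym-ust-18916-p1` (gen 0).  The registered stub `stub_perPlaquetteOfAlpha` of K2's birth v3b (skeleton sha16
`cf09887d813eb370`) asks, given Bałaban's (α) package, for `C ≥ 0`, `A : ℕ`, `c > 0` with
`Gibbs_K{U : θ(K−j) ≤ |Ū^{j}(∂p) − 1|} ≤ C·β_{K−j}^A·exp(−c·p(g_{K−j})²)` for EVERY cutoff `K`, EVERY height `1 ≤ j ≤ K` and every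
plaquette `p` of `T^{(j)}` (`Ū^{j}` the `j`-fold (0.4) block average with the exp-mean-log small-loop average `ℰp` on `SU(2)`,
`θ(i) = g_i p(g_i)`, `g_i² = γL^{−i}`, `β_i = L^i/γ`, `p = B10.pFun b₀ p₀`).

THIS FILE proves the schema WITHOUT any hypothesis for the heights `j ≤ j₀`, for every fixed `j₀` (constants
`C = 144·e^{24}·c₀^{−3}·L^{3m+8j₀}`, `A = 8`, `c = ¼·(151L²)^{−2j₀}`, `c₀ = c₀(SU(2))` the Haar small-ball constant of
`T3FinestHeightTail.gibbsMeasure_real_dist1_ge_le`), i.e. **`unitScaleTilt_perPlaquette_boundedHeight`**: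

* DETERMINISTIC STEP (`plaqSmall_iter_blockAvg`): the tree's crude Prop 1 for (0.4),
  `BlockAveragingPlaquetteBound.plaqSmall_blockAvg_expMeanLogSU` — `PlaqSmall a U ⇒ PlaqSmall (151L²·a) (Ū)` under the guard
  `(25L²/4)·a < δ₂` — iterated `j` times: `PlaqSmall a U ⇒ PlaqSmall ((151L²)^j a) (Ū^{j})`; hence the height-`j` large-plaquette event
  is contained in the FINE large-field event `{U : ¬PlaqSmall (θ(K−j)/(151L²)^j) U}` (`event_subset_not_plaqSmall`; the guard holds because
  `θ(K−j) ≤ 2`, else the event is empty: `dist1 ≤ 2` on `SU(2)`);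
* PROBABILISTIC STEP: the finest-height engine (reflection positivity + chessboard, `gibbsMeasure_real_dist1_ge_le`, `d = 3`, `N = 2`) and
  the union bound over the `≤ 72·L^{3(m+K)}` fine plaquettes: `Gibbs_K{¬PlaqSmall a} ≤ #P(T^{(0)}_K)·2e^{24}c₀^{−3}(√β_K)^9 e^{−β_K a²/4}`;
* ARITHMETIC: `β_K = L^j β_{K−j}`, `β_{K−j}θ(K−j)² = p(g_{K−j})²` (`beta_mul_θBal_sq`), `L^{K−j} = γβ_{K−j} ≤ β_{K−j}`, so at `j ≤ j₀` the
  bound is `≤ C·β_{K−j}^8·exp(−p²/(4(151L²)^{2j}·L^{−j})) ≤ C·β_{K−j}^8·exp(−c·p²)`.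

WHAT THIS IS NOT.  The per-step loss `(151L²)²/L` in the Gaussian exponent is the «averaging is smoothing» obstruction of the owner's
K2 memo §1: the schema at UNBOUNDED height — the located, unprinted content of K2 ([Balaban1985UV3] (41)/(47)/(71)) — is NOT proved,
and no bounded-height statement implies `AveragedTailAt`.  Kernel certificate that the open content of `stub_perPlaquetteOfAlpha` is
UNIFORMITY IN THE HEIGHT; any argument for the heights `j > j₀` combines with this one (`perPlaquette_of_split`).  Nothing uses (α).
-/

noncomputable section

open MeasureTheory
open scoped BigOperators
open Literature.MathematicalPhysics.QuantumFieldTheory (Plaquette)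
open Literature.MathematicalPhysics.QuantumFieldTheory.Balaban1983to89
open Literature.MathematicalPhysics.QuantumFieldTheory.Balaban1983to89.T3ContinuumYM3Torus
open Literature.MathematicalPhysics.QuantumFieldTheory.Balaban1983to89.T3UnitScaleTilt
open Literature.MathematicalPhysics.QuantumFieldTheory.Balaban1983to89.T3UnitLawDensityEML
open Literature.MathematicalPhysics.QuantumFieldTheory.Balaban1983to89.T3CruxEstimates
open Literature.MathematicalPhysics.QuantumFieldTheory.Balaban1983to89.T3FinestHeightTail
open Literature.MathematicalPhysics.QuantumFieldTheory.Balaban1983to89.T3Thresholds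
open Literature.MathematicalPhysics.QuantumFieldTheory.Balaban1983to89.T3ThresholdSmallness (sqrt_coupling_pos_le)
open Literature.MathematicalPhysics.QuantumFieldTheory.Balaban1983to89.BlockAveragingPlaquetteBound
open Literature.MathematicalPhysics.QuantumFieldTheory.Balaban1983to89.ExpMeanLog (deltaSU deltaSU_pos expMeanLogSU)
open Literature.MathematicalPhysics.QuantumFieldTheory.Balaban1983to89.T4PairDerivBridge (dist1_le_two_specialUnitaryGroup)
open Literature.MathematicalPhysics.QuantumFieldTheory.Balaban1983to89.T3UpperLiftSplit (scheme_β_eq)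

namespace Summit.QuantumFields.YangMills.Theorems.HistoryTailBoundedHeight

/-! ## §1 The deterministic step: `j`-fold averaging of a small field -/

section Deterministic

variable (F : T3Family)

/-- The one-step constant of the tree's crude Prop 1 for (0.4) in `d = 3` is `L² + 6(5L)² = 151·L²` (written `151·L²` throughout
this file). [cite: Balaban1985Averaging, Prop. 1 (51) p.26] -/
theorem lam_eq : (F.L : ℝ) ^ 2 + 6 * (((3 + 2) * F.L : ℕ) : ℝ) ^ 2 = 151 * (F.L : ℝ) ^ 2 := by
  push_cast; ring

/-- `1 ≤ 151·L²`. [folklore] -/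
theorem one_le_lam : (1 : ℝ) ≤ 151 * (F.L : ℝ) ^ 2 := by
  have hL : (1 : ℝ) ≤ F.L := by exact_mod_cast F.hL.2.le
  nlinarith

/-- `0 < 151·L²`. [folklore] -/
theorem lam_pos : (0 : ℝ) < 151 * (F.L : ℝ) ^ 2 := lt_of_lt_of_le one_pos (one_le_lam F)

/-- `δ₂(SU(2)) = min(1/3, π/2) ≥ 1/3`. [folklore] -/
theorem third_le_deltaSU_two : (1 : ℝ) / 3 ≤ deltaSU (Fin 2) := by
  unfold deltaSU
  refine le_min le_rfl ?_
  rw [Fintype.card_fin]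
  have := Real.pi_gt_three
  push_cast
  linarith

/-- **`j`-FOLD AVERAGING OF A SMALL FIELD** (the crude Prop 1 for (0.4) iterated): if `PlaqSmall a U` on the finest lattice of the `K`-th
approximation, `0 ≤ a`, `j ≤ K`, and the guard `(25L²/4)·Λ^s·a < δ₂` holds for all `s < j`, then `PlaqSmall (Λ^j·a) (Ū^{j})`.
[cite: Balaban1985Averaging, Prop. 1 (51) p.26] -/
theorem plaqSmall_iter_blockAvg {K : ℕ} {a : ℝ} (ha : 0 ≤ a)
    {U : GaugeField (F.P K) 0 (Matrix.specialUnitaryGroup (Fin 2) ℂ)} (hU : PlaqSmall a U) :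
    ∀ j : ℕ, j ≤ K → (∀ s, s < j → ((((3 + 2) * F.L : ℕ) : ℝ) ^ 2 / 4) * ((151 * (F.L : ℝ) ^ 2) ^ s * a) < deltaSU (Fin 2)) →
      PlaqSmall ((151 * (F.L : ℝ) ^ 2) ^ j * a) (Averaging.iter (fun _ => BlockAveraging.blockAvg ℰp) j U)
  | 0, _, _ => by
    show PlaqSmall ((151 * (F.L : ℝ) ^ 2) ^ 0 * a) U
    rw [pow_zero, one_mul]; exact hU
  | j + 1, hjK, hguard => by
    have hprev := plaqSmall_iter_blockAvg ha hU j (by omega) fun s hs => hguard s (by omega)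
    have hj : j + 1 ≤ (F.P K).m + (F.P K).K := by
      show j + 1 ≤ F.m + K; omega
    have ha' : 0 ≤ (151 * (F.L : ℝ) ^ 2) ^ j * a := mul_nonneg (pow_nonneg (lam_pos F).le j) ha
    have hstep := plaqSmall_blockAvg_expMeanLogSU (P := F.P K) (n := Fin 2) hj ha' hprev (hguard j (Nat.lt_succ_self j))
    intro p
    have h := hstep p
    refine h.trans_le (le_of_eq ?_)
    show ((F.L : ℝ) ^ 2 + 6 * (((3 + 2) * F.L : ℕ) : ℝ) ^ 2) * ((151 * (F.L : ℝ) ^ 2) ^ j * a) =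
      (151 * (F.L : ℝ) ^ 2) ^ (j + 1) * a
    rw [lam_eq, pow_succ]; ring

/-- **THE HEIGHT-`j` LARGE-PLAQUETTE EVENT LIES IN A FINE LARGE-FIELD EVENT**: for `0 ≤ θ ≤ 2` and `j ≤ K`,
`{U : θ ≤ |Ū^{j}(∂p) − 1|} ⊆ {U : ¬PlaqSmall (θ/Λ^j) U}` (the guard `(25L²/4)·θ/Λ ≤ 50/604 < 1/3 ≤ δ₂` holds automatically).
[cite: Balaban1985Averaging, Prop. 1 (51) p.26] -/
theorem event_subset_not_plaqSmall {K j : ℕ} (hjK : j ≤ K) {θ : ℝ} (hθ0 : 0 ≤ θ) (hθ2 : θ ≤ 2) (p : Plaq (F.P K) j) :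
    {U : GaugeField (F.P K) 0 (Matrix.specialUnitaryGroup (Fin 2) ℂ) |
        θ ≤ GaugeGroup.dist1 (GaugeField.plaqHol (Averaging.iter (fun _ => BlockAveraging.blockAvg ℰp) j U) p)} ⊆
      {U | ¬ PlaqSmall (θ / (151 * (F.L : ℝ) ^ 2) ^ j) U} := by
  intro U hU hsmall
  have hΛ := lam_pos F
  have hΛj : 0 < (151 * (F.L : ℝ) ^ 2) ^ j := pow_pos hΛ j
  have ha : 0 ≤ θ / (151 * (F.L : ℝ) ^ 2) ^ j := div_nonneg hθ0 hΛj.le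
  -- the guard at every step `s < j`
  have hguard : ∀ s, s < j → ((((3 + 2) * F.L : ℕ) : ℝ) ^ 2 / 4) * ((151 * (F.L : ℝ) ^ 2) ^ s * (θ / (151 * (F.L : ℝ) ^ 2) ^ j)) < deltaSU (Fin 2) := by
    intro s hs
    have hL : (1 : ℝ) ≤ F.L := by exact_mod_cast F.hL.2.le
    have hL2 : 0 < (F.L : ℝ) ^ 2 := by positivity
    -- `Λ^s / Λ^j ≤ 1/Λ`
    have hratio : (151 * (F.L : ℝ) ^ 2) ^ s * (θ / (151 * (F.L : ℝ) ^ 2) ^ j) ≤ θ / (151 * (F.L : ℝ) ^ 2) := by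
      rw [mul_div_assoc', div_le_div_iff₀ hΛj hΛ]
      have hpow : (151 * (F.L : ℝ) ^ 2) ^ s * (151 * (F.L : ℝ) ^ 2) ≤ (151 * (F.L : ℝ) ^ 2) ^ j := by
        rw [← pow_succ]
        exact pow_le_pow_right₀ (one_le_lam F) (by omega)
      calc (151 * (F.L : ℝ) ^ 2) ^ s * θ * (151 * (F.L : ℝ) ^ 2) = θ * ((151 * (F.L : ℝ) ^ 2) ^ s * (151 * (F.L : ℝ) ^ 2)) := by ring
        _ ≤ θ * (151 * (F.L : ℝ) ^ 2) ^ j := mul_le_mul_of_nonneg_left hpow hθ0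
    have hcast : (((3 + 2) * F.L : ℕ) : ℝ) = 5 * F.L := by push_cast; ring
    rw [hcast]
    calc (5 * (F.L : ℝ)) ^ 2 / 4 * ((151 * (F.L : ℝ) ^ 2) ^ s * (θ / (151 * (F.L : ℝ) ^ 2) ^ j))
        ≤ (5 * (F.L : ℝ)) ^ 2 / 4 * (θ / (151 * (F.L : ℝ) ^ 2)) := mul_le_mul_of_nonneg_left hratio (by positivity)
      _ = 25 * θ / 604 := by field_simp; ring
      _ < 1 / 3 := by linarith
      _ ≤ deltaSU (Fin 2) := third_le_deltaSU_two
  have hiter := plaqSmall_iter_blockAvg F ha hsmall j hjK hguard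
  have hp := hiter p
  rw [div_eq_mul_inv, ← mul_assoc, mul_comm ((151 * (F.L : ℝ) ^ 2) ^ j), mul_assoc, mul_inv_cancel₀ hΛj.ne', mul_one] at hp
  exact absurd hU (not_le.mpr hp)

end Deterministic

/-! ## §2 The probabilistic step: the finest-height engine at an arbitrary radius, union bound -/

section FineTail

/-- `#plaquettes of T^{(j)} ≤ 9·(sites per direction)³` (`d² = 9` plane labels per site; same computation as the private helper of
`T3AveragedTailProfile`). [cite: Balaban1985UV3, (1)-(3) p.256] -/
theorem card_plaq_le (F : T3Family) (K j : ℕ) :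
    (Fintype.card (Plaq (F.P K) j) : ℝ) ≤ 9 * ((F.P K).sitesPerDir j : ℝ) ^ 3 := by
  have h1 : Fintype.card (Plaq (F.P K) j) = Fintype.card (Plaquette 3 ((F.P K).sitesPerDir j)) :=
    Fintype.card_congr (plaqEquiv (P := F.P K) j)
  have h2 : Fintype.card (Plaquette 3 ((F.P K).sitesPerDir j)) ≤ ((F.P K).sitesPerDir j) ^ 3 * 3 ^ 2 := by
    rw [Fintype.card_prod, Fintype.card_fun, ZMod.card, Fintype.card_fin]
    gcongr
    calc Fintype.card {p : Fin 3 × Fin 3 // p.1 < p.2} ≤ Fintype.card (Fin 3 × Fin 3) := Fintype.card_subtype_le _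
      _ = 3 ^ 2 := by rw [Fintype.card_prod, Fintype.card_fin]; norm_num
  rw [h1]
  calc (Fintype.card (Plaquette 3 ((F.P K).sitesPerDir j)) : ℝ) ≤ (((F.P K).sitesPerDir j) ^ 3 * 3 ^ 2 : ℕ) := by
        exact_mod_cast h2
    _ = 9 * ((F.P K).sitesPerDir j : ℝ) ^ 3 := by push_cast; ring

/-- **THE FINE LARGE-FIELD TAIL AT AN ARBITRARY RADIUS** (`a ≥ 0`, `β_K ≥ 1`): `Gibbs_K{U : ¬PlaqSmall a U} ≤
#P(T^{(0)}_K)·2e^{24}c₀^{−3}(√β_K)^9·exp(−β_K a²/4)` — union bound over the fine plaquettes and the reflection-positivity/chessboard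
engine `gibbsMeasure_real_dist1_ge_le` (`d = 3`, `N = 2`). [cite: Balaban1985UV3, (11) p.258 and (71) p.273] -/
theorem gibbsK_real_not_plaqSmall_le_of_radius :
    ∃ c₀ : ℝ, 0 < c₀ ∧ c₀ ≤ 1 ∧ ∀ (F : T3Family) (γ : ℝ), 0 < γ → ∀ (K : ℕ) (a : ℝ), 0 ≤ a →
      1 ≤ (F.scheme ℰp γ).β K →
        (gibbsK F ℰp γ K).real {U | ¬ PlaqSmall a U} ≤
          Fintype.card (Plaq (F.P K) 0) *
            (2 * Real.exp 24 * (c₀ ^ 3)⁻¹ * Real.sqrt ((F.scheme ℰp γ).β K) ^ 9 *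
              Real.exp (-((F.scheme ℰp γ).β K * a ^ 2 / 4))) := by
  obtain ⟨c, hc, hc1, h⟩ := gibbsMeasure_real_dist1_ge_le (N := 2)
  refine ⟨c, hc, hc1, fun F γ hγ K a ha hβ => ?_⟩
  haveI := isProbabilityMeasure_gibbsK F ℰp hγ.le K
  have hunion := real_not_plaqSmall_comp_le_sum (gibbsK F ℰp γ K)
    (fun U : GaugeField (F.P K) 0 (Matrix.specialUnitaryGroup (Fin 2) ℂ) => U) a
  refine hunion.trans ?_
  have hcard2 : Fintype.card {q : Fin (F.P K).d × Fin (F.P K).d // q.1 < q.2} = 3 := by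
    rw [show (F.P K).d = 3 from rfl]; decide
  have hd3 : (F.P K).d = 3 := rfl
  have hterm : ∀ p : Plaq (F.P K) 0,
      (gibbsK F ℰp γ K).real {U | a ≤ GaugeGroup.dist1 (GaugeField.plaqHol U p)} ≤
        2 * Real.exp 24 * (c ^ 3)⁻¹ * Real.sqrt ((F.scheme ℰp γ).β K) ^ 9 *
          Real.exp (-((F.scheme ℰp γ).β K * a ^ 2 / 4)) := by
    intro p
    have hp1 := h (F.P K) ((F.scheme ℰp γ).β K) hβ a ha p
    rw [gibbsK_eq]
    refine hp1.trans (le_of_eq ?_)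
    rw [hcard2, hd3]
    have hexp : (F.scheme ℰp γ).β K * a ^ 2 / (2 * (2 : ℕ)) = (F.scheme ℰp γ).β K * a ^ 2 / 4 := by norm_num
    rw [hexp]
    norm_num
  calc ∑ p : Plaq (F.P K) 0, (gibbsK F ℰp γ K).real {U | a ≤ GaugeGroup.dist1 (GaugeField.plaqHol U p)}
      ≤ ∑ _p : Plaq (F.P K) 0, (2 * Real.exp 24 * (c ^ 3)⁻¹ * Real.sqrt ((F.scheme ℰp γ).β K) ^ 9 *
          Real.exp (-((F.scheme ℰp γ).β K * a ^ 2 / 4))) := Finset.sum_le_sum fun p _ => hterm p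
    _ = _ := by rw [Finset.sum_const, Finset.card_univ, nsmul_eq_mul]

end FineTail

/-! ## §3 Arithmetic of the family's couplings -/

section Arithmetic

variable (F : T3Family) {γ : ℝ}

/-- `β_{i+j} = L^j·β_i`. [cite: Balaban1985UV3, (3) p.256] -/
theorem scheme_β_add (γ : ℝ) (i j : ℕ) :
    (F.scheme ℰp γ).β (i + j) = (F.L : ℝ) ^ j * (F.scheme ℰp γ).β i := by
  rw [scheme_β_eq, scheme_β_eq, pow_add, ← mul_assoc, mul_inv, inv_pow, inv_pow, inv_inv, mul_comm]

/-- `1 ≤ β_i` for `0 < γ ≤ 1`. [cite: Balaban1985UV3, (3) p.256] -/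
theorem one_le_scheme_β (hγ : 0 < γ) (hγ1 : γ ≤ 1) (i : ℕ) : 1 ≤ (F.scheme ℰp γ).β i := by
  have hL : (1 : ℝ) ≤ F.L := by exact_mod_cast F.hL.2.le
  have hLi : (1 : ℝ) ≤ (F.L : ℝ) ^ i := one_le_pow₀ hL
  have hLi0 : (0 : ℝ) < (F.L : ℝ) ^ i := by positivity
  rw [scheme_β_eq, inv_pow, mul_inv, inv_inv]
  rw [show γ⁻¹ * (F.L : ℝ) ^ i = (F.L : ℝ) ^ i / γ by ring, le_div_iff₀ hγ]
  linarith

/-- `L^i = γ·β_i ≤ β_i` for `0 < γ ≤ 1`. [cite: Balaban1985UV3, (3) p.256] -/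
theorem pow_le_scheme_β (hγ : 0 < γ) (hγ1 : γ ≤ 1) (i : ℕ) : (F.L : ℝ) ^ i ≤ (F.scheme ℰp γ).β i := by
  have hLi0 : (0 : ℝ) ≤ (F.L : ℝ) ^ i := by positivity
  rw [scheme_β_eq, inv_pow, mul_inv, inv_inv]
  calc (F.L : ℝ) ^ i = 1 * (F.L : ℝ) ^ i := (one_mul _).symm
    _ ≤ γ⁻¹ * (F.L : ℝ) ^ i := mul_le_mul_of_nonneg_right (one_le_inv_iff₀.mpr ⟨hγ, hγ1⟩) hLi0

/-- `θ(i) ≥ 0` for `0 < γ ≤ 1`, `0 ≤ b₀`. [cite: Balaban1985UV3, (7) p.257] -/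
theorem θBal_nonneg' (hγ : 0 < γ) (hγ1 : γ ≤ 1) {b₀ : ℝ} (hb : 0 ≤ b₀) (p₀ : ℝ) (i : ℕ) : 0 ≤ θBal F.L γ b₀ p₀ i := by
  have hL : 1 ≤ F.L := F.hL.2.le
  rw [θBal_eq]
  exact mul_nonneg (Real.sqrt_nonneg _)
    (B10.pFun_nonneg b₀ p₀ _ hb (sqrt_coupling_pos_le hL hγ i).1 (coupling_le_one hL hγ hγ1 i))

end Arithmetic

/-! ## §4 The per-plaquette schema at bounded height -/

section Main

/-- **THE PER-PLAQUETTE LARGE-FIELD TAIL OF THE BLOCK-AVERAGED FIELDS AT BOUNDED HEIGHT, UNCONDITIONALLY.**  For every `j₀`, every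
family `F`, every coupling `0 < γ ≤ 1` and every profile `b₀ ≥ 0`, `p₀`, there are `C ≥ 0`, `A : ℕ` (`= 8`), `c > 0` such that for
every cutoff `K`, every height `j ≤ min(K, j₀)` and every plaquette `p` of `T^{(j)}`,
`Gibbs_K{U : θ(K−j) ≤ |Ū^{j}(∂p) − 1|} ≤ C·β_{K−j}^A·exp(−c·p(g_{K−j})²)` — the body of the registered stub `stub_perPlaquetteOfAlpha`
restricted to `j ≤ j₀`, with no (α) input: crude Prop 1 for (0.4) iterated + reflection positivity/chessboard at the finest height +
union bound.  The constants degrade like `c = ¼(151L²)^{−2j₀}`: the schema at unbounded height (K2's content) is NOT claimed.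
[cite: Balaban1985UV3, (7) p.257, (11) p.258 and (71) p.273; Balaban1985Averaging, Prop. 1 (51) p.26] -/
theorem unitScaleTilt_perPlaquette_boundedHeight (j₀ : ℕ) (F : T3Family) {γ : ℝ} (hγ : 0 < γ) (hγ1 : γ ≤ 1)
    {b₀ : ℝ} (hb₀ : 0 ≤ b₀) (p₀ : ℝ) :
    ∃ (C : ℝ) (A : ℕ) (c : ℝ), 0 ≤ C ∧ 0 < c ∧
      ∀ (K j : ℕ), j ≤ K → j ≤ j₀ → ∀ p : Plaq (F.P K) j,
        (gibbsK F ℰp γ K).real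
            {U | θBal F.L γ b₀ p₀ (K - j) ≤
              GaugeGroup.dist1 (GaugeField.plaqHol
                (Averaging.iter (fun _ => BlockAveraging.blockAvg ℰp) j U) p)} ≤
          C * (F.scheme ℰp γ).β (K - j) ^ A *
            Real.exp (-(c * B10.pFun b₀ p₀ (Real.sqrt (γ * ((F.L : ℝ)⁻¹) ^ (K - j))) ^ 2)) := by
  obtain ⟨c₀, hc₀, _, htail⟩ := gibbsK_real_not_plaqSmall_le_of_radius
  have hL1 : (1 : ℝ) ≤ F.L := by exact_mod_cast F.hL.2.le
  have hL0 : (0 : ℝ) < F.L := by positivity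
  have hΛ1 := one_le_lam F
  have hΛ0 := lam_pos F
  -- the constants
  set C : ℝ := 144 * Real.exp 24 * (c₀ ^ 3)⁻¹ * (F.L : ℝ) ^ (3 * F.m + 8 * j₀) with hC
  set c : ℝ := 1 / (4 * ((151 * (F.L : ℝ) ^ 2) ^ j₀) ^ 2) with hc
  have hC0 : 0 ≤ C := by positivity
  have hc0 : 0 < c := by positivity
  refine ⟨C, 8, c, hC0, hc0, fun K j hjK hj0 p => ?_⟩
  -- names
  set i : ℕ := K - j with hi
  have hK : K = i + j := by omega
  set βi : ℝ := (F.scheme ℰp γ).β i with hβi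
  set βK : ℝ := (F.scheme ℰp γ).β K with hβK
  set θ : ℝ := θBal F.L γ b₀ p₀ i with hθ
  set pg : ℝ := B10.pFun b₀ p₀ (Real.sqrt (γ * ((F.L : ℝ)⁻¹) ^ i)) with hpg
  have hβKeq : βK = (F.L : ℝ) ^ j * βi := by rw [hβK, hK, scheme_β_add]
  have hβi1 : 1 ≤ βi := one_le_scheme_β F hγ hγ1 i
  have hβK1 : 1 ≤ βK := one_le_scheme_β F hγ hγ1 K
  have hθ0 : 0 ≤ θ := θBal_nonneg' F hγ hγ1 hb₀ p₀ i
  have hLj1 : (1 : ℝ) ≤ (F.L : ℝ) ^ j := one_le_pow₀ hL1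
  have hβθ : βi * θ ^ 2 = pg ^ 2 := beta_mul_θBal_sq F hγ b₀ p₀ i
  -- the right-hand side is non-negative
  have hRHS0 : 0 ≤ C * βi ^ 8 * Real.exp (-(c * pg ^ 2)) := by positivity
  -- trivial case `θ > 2`: the event is empty
  by_cases hθ2 : 2 < θ
  · have hempty : {U : GaugeField (F.P K) 0 (Matrix.specialUnitaryGroup (Fin 2) ℂ) |
        θ ≤ GaugeGroup.dist1 (GaugeField.plaqHol (Averaging.iter (fun _ => BlockAveraging.blockAvg ℰp) j U) p)} = ∅ := by
      ext U
      simp only [Set.mem_setOf_eq, Set.mem_empty_iff_false, iff_false, not_le]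
      exact (dist1_le_two_specialUnitaryGroup _).trans_lt hθ2
    rw [hempty, measureReal_empty]
    exact hRHS0
  rw [not_lt] at hθ2
  -- main case: the event lies in the fine large-field event of radius `a = θ/Λ^j`
  set a : ℝ := θ / (151 * (F.L : ℝ) ^ 2) ^ j with ha
  have hΛj0 : 0 < (151 * (F.L : ℝ) ^ 2) ^ j := pow_pos hΛ0 j
  have ha0 : 0 ≤ a := div_nonneg hθ0 hΛj0.le
  haveI := isProbabilityMeasure_gibbsK F ℰp hγ.le K
  have hsub := event_subset_not_plaqSmall F hjK hθ0 hθ2 p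
  have hmono : (gibbsK F ℰp γ K).real
      {U | θ ≤ GaugeGroup.dist1 (GaugeField.plaqHol (Averaging.iter (fun _ => BlockAveraging.blockAvg ℰp) j U) p)} ≤
      (gibbsK F ℰp γ K).real {U | ¬ PlaqSmall a U} :=
    measureReal_mono hsub (measure_ne_top _ _)
  refine hmono.trans ((htail F γ hγ K a ha0 hβK1).trans ?_)
  -- (i) the number of fine plaquettes: `≤ 72 L^{3m} L^{3j} L^{3i} ≤ 72 L^{3m+3j₀} βi³`
  have hsites : ((F.P K).sitesPerDir 0 : ℝ) = 2 * (F.L : ℝ) ^ (F.m + K) := by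
    rw [show (F.P K).sitesPerDir 0 = 2 * F.L ^ (F.m + K - 0) from rfl, Nat.sub_zero]; push_cast; ring
  have hcard : (Fintype.card (Plaq (F.P K) 0) : ℝ) ≤ 72 * (F.L : ℝ) ^ (3 * F.m + 3 * j₀) * βi ^ 3 := by
    refine (card_plaq_le F K 0).trans ?_
    rw [hsites, hK]
    have hLi : ((F.L : ℝ) ^ i) ^ 3 ≤ βi ^ 3 := by
      gcongr
      exact pow_le_scheme_β F hγ hγ1 i
    have hLj : ((F.L : ℝ) ^ j) ^ 3 ≤ ((F.L : ℝ) ^ j₀) ^ 3 := by gcongr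
    calc 9 * (2 * (F.L : ℝ) ^ (F.m + (i + j))) ^ 3
        = 72 * ((F.L : ℝ) ^ F.m) ^ 3 * ((F.L : ℝ) ^ j) ^ 3 * ((F.L : ℝ) ^ i) ^ 3 := by rw [pow_add, pow_add]; ring
      _ ≤ 72 * ((F.L : ℝ) ^ F.m) ^ 3 * ((F.L : ℝ) ^ j₀) ^ 3 * βi ^ 3 := by gcongr
      _ = 72 * (F.L : ℝ) ^ (3 * F.m + 3 * j₀) * βi ^ 3 := by ring
  -- (ii) the polynomial prefactor: `(√βK)^9 ≤ βK^5 = L^{5j} βi^5 ≤ L^{5j₀} βi^5`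
  have hsqrt : Real.sqrt βK ^ 9 ≤ (F.L : ℝ) ^ (5 * j₀) * βi ^ 5 := by
    have hs1 : 1 ≤ Real.sqrt βK := by rw [← Real.sqrt_one]; exact Real.sqrt_le_sqrt hβK1
    have h9 : Real.sqrt βK ^ 9 ≤ Real.sqrt βK ^ 10 := pow_le_pow_right₀ hs1 (by norm_num)
    have h10 : Real.sqrt βK ^ 10 = βK ^ 5 := by
      rw [show (10 : ℕ) = 2 * 5 from rfl, pow_mul, Real.sq_sqrt (zero_le_one.trans hβK1)]
    refine h9.trans ?_
    rw [h10, hβKeq, mul_pow, ← pow_mul]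
    exact mul_le_mul_of_nonneg_right (pow_le_pow_right₀ hL1 (by omega)) (by positivity)
  -- (iii) the Gaussian factor: `βK a²/4 = L^j p²/(4Λ^{2j}) ≥ c p²`
  have hgauss : Real.exp (-(βK * a ^ 2 / 4)) ≤ Real.exp (-(c * pg ^ 2)) := by
    refine Real.exp_le_exp.mpr (neg_le_neg ?_)
    have hΛjj : ((151 * (F.L : ℝ) ^ 2) ^ j) ^ 2 ≤ ((151 * (F.L : ℝ) ^ 2) ^ j₀) ^ 2 := by gcongr
    have hpg2 : 0 ≤ pg ^ 2 := sq_nonneg _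
    have hkey : βK * a ^ 2 / 4 = (F.L : ℝ) ^ j * pg ^ 2 / (4 * ((151 * (F.L : ℝ) ^ 2) ^ j) ^ 2) := by
      rw [ha, hβKeq, div_pow, ← hβθ]
      field_simp
    rw [hkey, hc]
    calc 1 / (4 * ((151 * (F.L : ℝ) ^ 2) ^ j₀) ^ 2) * pg ^ 2 ≤ 1 / (4 * ((151 * (F.L : ℝ) ^ 2) ^ j) ^ 2) * pg ^ 2 := by
          apply mul_le_mul_of_nonneg_right _ hpg2
          gcongr
      _ = 1 * pg ^ 2 / (4 * ((151 * (F.L : ℝ) ^ 2) ^ j) ^ 2) := by ring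
      _ ≤ (F.L : ℝ) ^ j * pg ^ 2 / (4 * ((151 * (F.L : ℝ) ^ 2) ^ j) ^ 2) := by
          gcongr
  -- assemble
  calc (Fintype.card (Plaq (F.P K) 0) : ℝ) *
        (2 * Real.exp 24 * (c₀ ^ 3)⁻¹ * Real.sqrt βK ^ 9 * Real.exp (-(βK * a ^ 2 / 4)))
      ≤ (72 * (F.L : ℝ) ^ (3 * F.m + 3 * j₀) * βi ^ 3) *
        (2 * Real.exp 24 * (c₀ ^ 3)⁻¹ * ((F.L : ℝ) ^ (5 * j₀) * βi ^ 5) * Real.exp (-(c * pg ^ 2))) := by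
        gcongr
    _ = C * βi ^ 8 * Real.exp (-(c * pg ^ 2)) := by
        rw [hC, show 3 * F.m + 8 * j₀ = (3 * F.m + 3 * j₀) + 5 * j₀ by omega, pow_add]
        ring

/-- **SPLIT BY HEIGHT**: the per-plaquette schema for ALL heights `1 ≤ j ≤ K` follows from any bound of the same shape valid for the
heights `j₀ < j ≤ K` (the located content of K2), combined with `unitScaleTilt_perPlaquette_boundedHeight` for `j ≤ j₀` — the two
triples of constants merge as `(max C C', max A A', min c c')` (`β ≥ 1`). [cite: Balaban1985UV3, (7) p.257 and (71) p.273] -/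
theorem perPlaquette_of_split (j₀ : ℕ) (F : T3Family) {γ : ℝ} (hγ : 0 < γ) (hγ1 : γ ≤ 1) {b₀ : ℝ} (hb₀ : 0 ≤ b₀) (p₀ : ℝ)
    (hhigh : ∃ (C : ℝ) (A : ℕ) (c : ℝ), 0 ≤ C ∧ 0 < c ∧
      ∀ (K j : ℕ), j₀ < j → j ≤ K → ∀ p : Plaq (F.P K) j,
        (gibbsK F ℰp γ K).real
            {U | θBal F.L γ b₀ p₀ (K - j) ≤
              GaugeGroup.dist1 (GaugeField.plaqHol
                (Averaging.iter (fun _ => BlockAveraging.blockAvg ℰp) j U) p)} ≤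
          C * (F.scheme ℰp γ).β (K - j) ^ A *
            Real.exp (-(c * B10.pFun b₀ p₀ (Real.sqrt (γ * ((F.L : ℝ)⁻¹) ^ (K - j))) ^ 2))) :
    ∃ (C : ℝ) (A : ℕ) (c : ℝ), 0 ≤ C ∧ 0 < c ∧
      ∀ (K j : ℕ), 1 ≤ j → j ≤ K → ∀ p : Plaq (F.P K) j,
        (gibbsK F ℰp γ K).real
            {U | θBal F.L γ b₀ p₀ (K - j) ≤
              GaugeGroup.dist1 (GaugeField.plaqHol
                (Averaging.iter (fun _ => BlockAveraging.blockAvg ℰp) j U) p)} ≤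
          C * (F.scheme ℰp γ).β (K - j) ^ A *
            Real.exp (-(c * B10.pFun b₀ p₀ (Real.sqrt (γ * ((F.L : ℝ)⁻¹) ^ (K - j))) ^ 2)) := by
  obtain ⟨C, A, c, hC, hc, hlow⟩ := unitScaleTilt_perPlaquette_boundedHeight j₀ F hγ hγ1 hb₀ p₀
  obtain ⟨C', A', c', hC', hc', hhigh⟩ := hhigh
  refine ⟨max C C', max A A', min c c', le_max_of_le_left hC, lt_min hc hc', fun K j hj1 hjK p => ?_⟩
  have hβ1 : 1 ≤ (F.scheme ℰp γ).β (K - j) := one_le_scheme_β F hγ hγ1 (K - j)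
  have hp2 : 0 ≤ B10.pFun b₀ p₀ (Real.sqrt (γ * ((F.L : ℝ)⁻¹) ^ (K - j))) ^ 2 := sq_nonneg _
  -- the common weakening `C β^A e^{−c p²} ≤ (max C C') β^{max A A'} e^{−(min c c') p²}`
  have hweak : ∀ {C₁ : ℝ} {A₁ : ℕ} {c₁ : ℝ}, 0 ≤ C₁ → C₁ ≤ max C C' → A₁ ≤ max A A' → min c c' ≤ c₁ →
      C₁ * (F.scheme ℰp γ).β (K - j) ^ A₁ *
          Real.exp (-(c₁ * B10.pFun b₀ p₀ (Real.sqrt (γ * ((F.L : ℝ)⁻¹) ^ (K - j))) ^ 2)) ≤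
        max C C' * (F.scheme ℰp γ).β (K - j) ^ (max A A') *
          Real.exp (-(min c c' * B10.pFun b₀ p₀ (Real.sqrt (γ * ((F.L : ℝ)⁻¹) ^ (K - j))) ^ 2)) := by
    intro C₁ A₁ c₁ hC₁ hCle hAle hcle
    gcongr
  by_cases hj : j ≤ j₀
  · exact (hlow K j hjK hj p).trans (hweak hC (le_max_left _ _) (le_max_left _ _) (min_le_left _ _))
  · exact (hhigh K j (not_le.mp hj) hjK p).trans (hweak hC' (le_max_right _ _) (le_max_right _ _) (min_le_right _ _))

end Main

end Summit.QuantumFields.YangMills.Theorems.HistoryTailBoundedHeight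

end
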